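import Summits.AtomisticToContinuum.FouriersLaw.Theorems.BondHeatUncertaintyBoundedResponseSurvivalSumRuleA
import HarnessLib

/-! # NODE g96 «SurvivalSumRule» — landing part B of 3 (lens-1 g96; bodies byte-identical to node/BondHeatUncertaintyBoundedResponseSurvivalSumRule.lean sha256 57583f39…; see that file's module docstring for the mathematics). -/

noncomputable section

open MeasureTheory ProbabilityTheory Filter Topology Set Function
open scoped NNReal ENNReal
open Literature.MathematicalPhysics.KineticTheory.HeatConduction
open Literature.MathematicalPhysics.KineticTheory OscillatorChain
open Summit.AtomisticToContinuum.FouriersLaw.Theorems.SubdiffusiveBondHeat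
open Summit.AtomisticToContinuum.FouriersLaw.Theorems.OddSectorIrreversibility
open Summit.AtomisticToContinuum.FouriersLaw.Theorems.BoundedResponse.TransientBand

namespace Summit.AtomisticToContinuum.FouriersLaw.Theorems.BoundedResponse.ParityFloor

open Summit.AtomisticToContinuum.FouriersLaw.Theses.BondHeatUncertainty (BoundedResponse)
open Summit.AtomisticToContinuum.FouriersLaw.Theses.GriffithsLimitExchange
  (BoundaryDEP KernelIntegrable FiniteHorizonTransmission PositiveTransmission VanishingSurvival TransmissionLaw)
open Summit.AtomisticToContinuum.FouriersLaw.Theorems.SubdiffusiveBondHeat.EscapeGrading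
  (escapeDeficit OhmicFloor ohmicFloor_iff_boundedResponse)

section SurvivalSumRule

variable {ω₂ lam β γ T : ℝ}

section Pinned

variable {N : ℕ}

/-! ## §3 The sum rule: `S^{stor}_N(t) → Λ_N/T²`, `Λ_N = ⟨H − ⟨H⟩, h₀⟩ = Var_T(H_N)/(2γ)` -/

/-- **Flip–Fubini identity over `(0,∞)`**: for strongly measurable `G ∈ L²(μ_T)`,
`∫ G(Θz) h₀(z) dμ_T = ∫_{(0,∞)} ⟨θ₀, P_s G⟩_{μ_T} ds` (detailed balance per `s`, then Fubini on `(0,∞)`; the `t = ∞` twin of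
`integral_flip_mul_increment_eq`). [new] -/
theorem integral_flip_mul_kinCorrector_eq (hω : 0 < ω₂) (hl : 0 < lam) (hβ : 0 < β) (hγ : 0 < γ) (hN : 0 < N)
    (hT : 0 < T) {G : PhaseSpace N → ℝ} (hGm : StronglyMeasurable G)
    (hG2 : Integrable (fun z => G z ^ 2) ((pinnedChain ω₂ lam β γ).gibbsMeasure N T)) :
    ∫ z, G (z.1, -z.2) * kinCorrector ω₂ lam β γ T N ⟨0, hN⟩ z ∂((pinnedChain ω₂ lam β γ).gibbsMeasure N T) =
      ∫ s in Ioi (0 : ℝ), ∫ z, kinObs T N ⟨0, hN⟩ z *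
        (∫ y, G y ∂((pinnedChain ω₂ lam β γ).transitionKernel N T T s.toNNReal z))
        ∂((pinnedChain ω₂ lam β γ).gibbsMeasure N T) := by
  set P := pinnedChain ω₂ lam β γ with hP
  haveI : IsProbabilityMeasure (P.gibbsMeasure N T) :=
    pinnedChain_isProbabilityMeasure_gibbsMeasure hω hl.le hβ.le γ N hT
  obtain ⟨hϑ0, h2ϑ, hϑ1⟩ := weight_facts hT
  obtain ⟨K, c, hK, hc, hb⟩ := harrisBound_exists hω hl.le hβ hγ hN hT hϑ0 hϑ1
  obtain ⟨hθm, hθ2⟩ := kinObs_sq_facts hω hl.le hβ hγ hN hT ⟨0, hN⟩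
  have h1 : ∀ s ∈ Ioi (0 : ℝ), ∫ z, kinObs T N ⟨0, hN⟩ z *
      (∫ y, G y ∂(P.transitionKernel N T T s.toNNReal z)) ∂(P.gibbsMeasure N T) =
      ∫ z, G (z.1, -z.2) * kinAct ω₂ lam β γ T N ⟨0, hN⟩ s z ∂(P.gibbsMeasure N T) := fun s _ => by
    have hDB := SubdiffusiveBondHeat.pinnedChain_detailedBalance hω hl hβ hγ hN hT
      (continuous_kinObs T ⟨0, hN⟩).measurable hGm.measurable hθ2 hG2 s.toNNReal
    refine hDB.trans (integral_congr_ae (Eventually.of_forall fun z => ?_))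
    dsimp only
    congr 1
    exact integral_congr_ae (Eventually.of_forall fun y => kinObs_reversal T ⟨0, hN⟩ y)
  rw [setIntegral_congr_fun measurableSet_Ioi h1]
  have hν : Integrable (fun y => Real.exp (2 * (1 / (4 * T)) * P.hamiltonian N y)) (P.gibbsMeasure N T) :=
    pinnedChain_integrable_exp_mul_hamiltonian_gibbsMeasure hω hl.le hβ.le γ N hT h2ϑ
  have hFm : StronglyMeasurable fun z : PhaseSpace N => G (z.1, -z.2) :=
    hGm.comp_measurable (measurable_fst.prodMk measurable_snd.neg)
  have hF2 : Integrable (fun z : PhaseSpace N => G (z.1, -z.2) ^ 2) (P.gibbsMeasure N T) :=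
    Cruxes.SuperadditiveResistance.FloatingProbeBypassLaplacian.integrable_flip_gibbsMeasure P N T
      (F := fun y => G y ^ 2) hG2
  rw [← integral_mul_setIntegral_kinAct hω hl.le hβ.le hγ.le hT hϑ0 hK.le hb hc ⟨0, hN⟩ (P.gibbsMeasure N T) hν hFm
    hF2 (S := Ioi 0) (fun s hs => hs)]
  rfl

/-- **`∫_{(0,∞)} g_N = Λ_N`**: the total storage kernel is the energy–corrector pairing (`G = H − ⟨H⟩` in the flip–Fubini
identity; `H∘Θ = H`). [new] -/
theorem integral_storageKernel_eq (hω : 0 < ω₂) (hl : 0 < lam) (hβ : 0 < β) (hγ : 0 < γ) (hN : 0 < N) (hT : 0 < T) :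
    ∫ s in Ioi 0, storageKernel ω₂ lam β γ T N s = energyPairing ω₂ lam β γ T N := by
  set P := pinnedChain ω₂ lam β γ with hP
  obtain ⟨hHm, -, hH2⟩ := centredHamiltonian_facts hω hl.le hβ hγ hN hT
  rw [energyPairing_of_pos hN]
  calc ∫ s in Ioi 0, storageKernel ω₂ lam β γ T N s
      = ∫ s in Ioi (0 : ℝ), ∫ z, kinObs T N ⟨0, hN⟩ z *
          (∫ y, (P.hamiltonian N y - ∫ x, P.hamiltonian N x ∂(P.gibbsMeasure N T))
            ∂(P.transitionKernel N T T s.toNNReal z)) ∂(P.gibbsMeasure N T) :=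
        setIntegral_congr_fun measurableSet_Ioi fun s _ => by rw [storageKernel, dif_pos hN]
    _ = ∫ z, (P.hamiltonian N (z.1, -z.2) - ∫ x, P.hamiltonian N x ∂(P.gibbsMeasure N T)) *
          kinCorrector ω₂ lam β γ T N ⟨0, hN⟩ z ∂(P.gibbsMeasure N T) :=
        (integral_flip_mul_kinCorrector_eq hω hl hβ hγ hN hT hHm hH2).symm
    _ = _ := integral_congr_ae (Eventually.of_forall fun z => by
        simp only [OscillatorChain.hamiltonian_neg_momentum, hP])

/-- **`g_N ∈ L¹(0,∞)`** — exponential decay of the centred cross-correlation `⟨θ₀, P_s(H − ⟨H⟩)⟩` (tree). [folklore] -/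
theorem integrableOn_storageKernel (hω : 0 < ω₂) (hl : 0 < lam) (hβ : 0 < β) (hγ : 0 < γ) (hN : 0 < N) (hT : 0 < T) :
    IntegrableOn (storageKernel ω₂ lam β γ T N) (Ioi 0) := by
  set P := pinnedChain ω₂ lam β γ with hP
  haveI : IsProbabilityMeasure (P.gibbsMeasure N T) :=
    pinnedChain_isProbabilityMeasure_gibbsMeasure hω hl.le hβ.le γ N hT
  set m : ℝ := ∫ x, P.hamiltonian N x ∂(P.gibbsMeasure N T) with hm
  obtain ⟨hϑ0, h2ϑ, hϑ1⟩ := weight_facts hT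
  obtain ⟨hHm, hHb, hH2⟩ := centredHamiltonian_facts hω hl.le hβ hγ hN hT
  have hHc : Continuous fun y => P.hamiltonian N y - m :=
    (pinnedChain_continuous_hamiltonian ω₂ lam β γ N).sub continuous_const
  have iHm : Integrable (fun y => P.hamiltonian N y - m) (P.gibbsMeasure N T) := by
    have h := integrable_mul_of_integrable_sq (g := fun _ => (1 : ℝ)) hHm.aestronglyMeasurable
      stronglyMeasurable_const.aestronglyMeasurable hH2 (by simp)
    simpa using h
  have iH : Integrable (P.hamiltonian N) (P.gibbsMeasure N T) :=
    (iHm.add (integrable_const m)).congr (Eventually.of_forall fun y => by simp)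
  have h0 : ∫ y, (P.hamiltonian N y - m) ∂(P.gibbsMeasure N T) = 0 := by
    rw [integral_sub iH (integrable_const m), hm]
    simp
  have h := AbelThermodynamicLimit.LoomisCompactHorizonWitness.pinnedChain_integrableOn_crossCorr hω hl.le hβ hγ hN hT
    hϑ0 h2ϑ (continuous_kinObs T ⟨0, hN⟩) (fun y => abs_kinObs_le (γ := γ) hω hl.le hβ.le hT.le hϑ0 ⟨0, hN⟩ y) hHc hHb h0
  refine h.congr_fun (fun s _ => ?_) measurableSet_Ioi
  rw [storageKernel, dif_pos hN]

/-- **`S^{stor}_N(t) → Λ_N/T²` as `t → ∞`** (`N ≥ 1`): `S^{stor}_N(t) = T⁻²∫₀ᵗ g_N`, `g_N ∈ L¹(0,∞)`, `∫₀^∞ g_N = Λ_N`. [new] -/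
theorem tendsto_storageResponse (hω : 0 < ω₂) (hl : 0 < lam) (hβ : 0 < β) (hγ : 0 < γ) (hN : 0 < N) (hT : 0 < T) :
    Tendsto (storageResponse ω₂ lam β γ T N) atTop (𝓝 (energyPairing ω₂ lam β γ T N / T ^ 2)) := by
  have hlim := intervalIntegral_tendsto_integral_Ioi 0 (integrableOn_storageKernel hω hl hβ hγ hN hT) tendsto_id
  rw [← integral_storageKernel_eq hω hl hβ hγ hN hT, div_eq_mul_one_div, mul_comm]
  refine (hlim.const_mul (1 / T ^ 2)).congr' ?_
  filter_upwards [eventually_ge_atTop (0 : ℝ)] with t ht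
  rw [storageResponse_eq_intervalIntegral hω hl hβ hγ hN hT ht]
  congr 1
  refine intervalIntegral.integral_congr fun s _ => ?_
  simp only [storageKernel, dif_pos hN]

/-- `θ_b ∘ R = θ_{rev b}` under the semigroup: `(P_t θ_b)(Rz) = (P_t θ_{rev b})(z)` (`R` the site reflection; the flow
commutes with `R`, tree `transitionKernel_siteReflection`). [folklore] -/
theorem kinAct_siteReflection (hω : 0 < ω₂) (hl : 0 ≤ lam) (hβ : 0 ≤ β) (hγ : 0 ≤ γ) (b : Fin N) (t : ℝ)
    (z : PhaseSpace N) :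
    kinAct ω₂ lam β γ T N b t (siteReflection N z) = kinAct ω₂ lam β γ T N (Fin.rev b) t z := by
  unfold kinAct
  rw [OddSectorWitness.transitionKernel_siteReflection hω hl hβ hγ N T t.toNNReal z,
    integral_map measurable_siteReflection.aemeasurable (continuous_kinObs T b).aestronglyMeasurable]
  rfl

/-- `h_b ∘ R = h_{rev b}`. [folklore] -/
theorem kinCorrector_siteReflection (hω : 0 < ω₂) (hl : 0 ≤ lam) (hβ : 0 ≤ β) (hγ : 0 ≤ γ) (b : Fin N)
    (z : PhaseSpace N) :
    kinCorrector ω₂ lam β γ T N b (siteReflection N z) = kinCorrector ω₂ lam β γ T N (Fin.rev b) z := by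
  simp only [kinCorrector, kinAct_siteReflection hω hl hβ hγ]

/-- `rev 0 = N − 1` in `Fin N`. [formal bookkeeping] -/
theorem fin_rev_zero (hN : 0 < N) : Fin.rev (⟨0, hN⟩ : Fin N) = ⟨N - 1, by omega⟩ :=
  Fin.ext (by simp [Fin.val_rev])

/-- **Left–right symmetry of the energy–corrector pairing**: `⟨H − ⟨H⟩, h₀⟩_{μ_T} = ⟨H − ⟨H⟩, h_{N−1}⟩_{μ_T}`
(`μ_T` and `H` are reflection invariant, `h₀∘R = h_{N−1}`). [new] -/
theorem energyPairing_zero_eq_last (hω : 0 < ω₂) (hl : 0 ≤ lam) (hβ : 0 ≤ β) (hγ : 0 ≤ γ) (hN : 0 < N) (T : ℝ) :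
    ∫ z, ((pinnedChain ω₂ lam β γ).hamiltonian N z -
          ∫ x, (pinnedChain ω₂ lam β γ).hamiltonian N x ∂((pinnedChain ω₂ lam β γ).gibbsMeasure N T)) *
        kinCorrector ω₂ lam β γ T N ⟨0, hN⟩ z ∂((pinnedChain ω₂ lam β γ).gibbsMeasure N T) =
      ∫ z, ((pinnedChain ω₂ lam β γ).hamiltonian N z -
          ∫ x, (pinnedChain ω₂ lam β γ).hamiltonian N x ∂((pinnedChain ω₂ lam β γ).gibbsMeasure N T)) *
        kinCorrector ω₂ lam β γ T N ⟨N - 1, by omega⟩ z ∂((pinnedChain ω₂ lam β γ).gibbsMeasure N T) := by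
  set P := pinnedChain ω₂ lam β γ with hP
  have hR : MeasurePreserving (siteReflection N) (P.gibbsMeasure N T) (P.gibbsMeasure N T) :=
    NonBallistic.measurePreserving_siteReflection_gibbsMeasure P (pinnedChain_V_neg ω₂ lam β γ) N T
  have hH : ∀ z, P.hamiltonian N (siteReflection N z) = P.hamiltonian N z := fun z =>
    P.hamiltonian_siteReflection (pinnedChain_V_neg ω₂ lam β γ) N z
  calc ∫ z, (P.hamiltonian N z - ∫ x, P.hamiltonian N x ∂(P.gibbsMeasure N T)) *
          kinCorrector ω₂ lam β γ T N ⟨0, hN⟩ z ∂(P.gibbsMeasure N T)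
      = ∫ z, (P.hamiltonian N (siteReflection N z) - ∫ x, P.hamiltonian N x ∂(P.gibbsMeasure N T)) *
          kinCorrector ω₂ lam β γ T N ⟨0, hN⟩ (siteReflection N z) ∂(P.gibbsMeasure N T) :=
        (hR.integral_comp (siteReflectionEquiv N).measurableEmbedding (fun z =>
          (P.hamiltonian N z - ∫ x, P.hamiltonian N x ∂(P.gibbsMeasure N T)) *
            kinCorrector ω₂ lam β γ T N ⟨0, hN⟩ z)).symm
    _ = _ := integral_congr_ae (Eventually.of_forall fun z => by
        dsimp only
        rw [hH z, kinCorrector_siteReflection hω hl hβ hγ, fin_rev_zero hN])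

/-- **`Λ_N = Var_T(H_N)/(2γ)`** (`N ≥ 2`): the pair identity `h₀ + h_{N−1} = (H − ⟨H⟩)/γ` a.e. and the reflection symmetry
`⟨H − ⟨H⟩, h₀⟩ = ⟨H − ⟨H⟩, h_{N−1}⟩`. [new] -/
theorem energyPairing_eq_half_variance (hω : 0 < ω₂) (hl : 0 < lam) (hβ : 0 < β) (hγ : 0 < γ) (hN : 2 ≤ N)
    (hT : 0 < T) :
    energyPairing ω₂ lam β γ T N = energyVariance ω₂ lam β γ T N / (2 * γ) := by
  set P := pinnedChain ω₂ lam β γ with hP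
  have hN0 : 0 < N := by omega
  obtain ⟨hHm, -, hH2⟩ := centredHamiltonian_facts hω hl.le hβ hγ hN0 hT
  obtain ⟨h0m, h02, -, -⟩ := corrector_sq_facts hω hl.le hβ hγ hN0 hT ⟨0, hN0⟩
  obtain ⟨h1m, h12, -, -⟩ := corrector_sq_facts hω hl.le hβ hγ hN0 hT ⟨N - 1, by omega⟩
  have i0 := integrable_mul_of_integrable_sq hHm.aestronglyMeasurable h0m.aestronglyMeasurable hH2 h02
  have i1 := integrable_mul_of_integrable_sq hHm.aestronglyMeasurable h1m.aestronglyMeasurable hH2 h12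
  have hpair := kinCorrector_pair_ae_eq hω hl.le hβ hγ hN hT
  have hsum : (∫ z, (P.hamiltonian N z - ∫ x, P.hamiltonian N x ∂(P.gibbsMeasure N T)) *
        kinCorrector ω₂ lam β γ T N ⟨0, hN0⟩ z ∂(P.gibbsMeasure N T)) +
      ∫ z, (P.hamiltonian N z - ∫ x, P.hamiltonian N x ∂(P.gibbsMeasure N T)) *
        kinCorrector ω₂ lam β γ T N ⟨N - 1, by omega⟩ z ∂(P.gibbsMeasure N T) =
      energyVariance ω₂ lam β γ T N / γ := by
    rw [← integral_add i0 i1, energyVariance, ← integral_div]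
    refine integral_congr_ae (hpair.mono fun z hz => ?_)
    dsimp only
    rw [← mul_add, hz]
    ring
  rw [← energyPairing_zero_eq_last hω hl.le hβ.le hγ.le hN0 T, ← energyPairing_of_pos hN0] at hsum
  have e : energyVariance ω₂ lam β γ T N / (2 * γ) = energyVariance ω₂ lam β γ T N / γ / 2 := by
    rw [div_div, mul_comm]
  rw [e, ← hsum]
  ring

/-- **`S^{stor}_N(t) ≤ Λ_N/T²` for every `t ≥ 0`** whenever `K_N + K̃_N ≥ 0` on `[0,∞)` (`N ≥ 2`): `S^{stor}_N` is
non-decreasing and tends to `Λ_N/T²`. [new] -/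
theorem storageResponse_le_energyPairing (hω : 0 < ω₂) (hl : 0 < lam) (hβ : 0 < β) (hγ : 0 < γ) (hN : 2 ≤ N)
    (hT : 0 < T) (hsum : ∀ u : ℝ, 0 ≤ u → 0 ≤ escapeKernel ω₂ lam β γ T N u + crossKernel ω₂ lam β γ T N u)
    {t : ℝ} (ht : 0 ≤ t) :
    storageResponse ω₂ lam β γ T N t ≤ energyPairing ω₂ lam β γ T N / T ^ 2 :=
  ge_of_tendsto (tendsto_storageResponse hω hl hβ hγ (by omega) hT)
    ((eventually_ge_atTop t).mono fun _ htt' => storageResponse_mono hω hl hβ hγ hN hT hsum ht htt')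

/-- **`S^{stor}_N(t) ≤ Var_T(H_N)/(2γT²)`** (`t ≥ 0`, `N ≥ 2`, `K_N + K̃_N ≥ 0`). [new] -/
theorem storageResponse_le_variance (hω : 0 < ω₂) (hl : 0 < lam) (hβ : 0 < β) (hγ : 0 < γ) (hN : 2 ≤ N)
    (hT : 0 < T) (hsum : ∀ u : ℝ, 0 ≤ u → 0 ≤ escapeKernel ω₂ lam β γ T N u + crossKernel ω₂ lam β γ T N u)
    {t : ℝ} (ht : 0 ≤ t) :
    storageResponse ω₂ lam β γ T N t ≤ energyVariance ω₂ lam β γ T N / (2 * γ * T ^ 2) := by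
  have h := storageResponse_le_energyPairing hω hl hβ hγ hN hT hsum ht
  rw [energyPairing_eq_half_variance hω hl hβ hγ hN hT, div_div] at h
  exact h

/-- **`S_N(t) ≤ Var_T(H_N)/(2γT²·t)`** for `t > 0` (`N ≥ 2`, `K_N + K̃_N ≥ 0`): `t·S_N(t) ≤ S^{stor}_N(t)`. [new] -/
theorem survival_le_variance_div (hω : 0 < ω₂) (hl : 0 < lam) (hβ : 0 < β) (hγ : 0 < γ) (hN : 2 ≤ N)
    (hT : 0 < T) (hsum : ∀ u : ℝ, 0 ≤ u → 0 ≤ escapeKernel ω₂ lam β γ T N u + crossKernel ω₂ lam β γ T N u)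
    {t : ℝ} (ht : 0 < t) :
    survival ω₂ lam β γ T N t ≤ energyVariance ω₂ lam β γ T N / (2 * γ * T ^ 2 * t) := by
  have h := (mul_survival_le_storageResponse hω hl hβ hγ hN hT hsum ht.le).trans
    (storageResponse_le_variance hω hl hβ hγ hN hT hsum ht.le)
  rw [le_div_iff₀ (by positivity)]
  rw [le_div_iff₀ (by positivity)] at h
  linarith

/-- **SURVIVAL SUM RULE.** For `N ≥ 2`, if `K_N + K̃_N ≥ 0` on `[0,∞)` then `S_N ∈ L¹(0,∞)` and
`∫_{(0,∞)} S_N(t) dt = Var_T(H_N)/(2γT²)` — the mean residence time of an injected energy quantum in the chain equals the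
canonical energy variance over `2γT²` (`= N/2` units at `γ = T = 1` in the harmonic case). [new] -/
theorem survival_sum_rule (hω : 0 < ω₂) (hl : 0 < lam) (hβ : 0 < β) (hγ : 0 < γ) (hN : 2 ≤ N) (hT : 0 < T)
    (hsum : ∀ u : ℝ, 0 ≤ u → 0 ≤ escapeKernel ω₂ lam β γ T N u + crossKernel ω₂ lam β γ T N u) :
    IntegrableOn (survival ω₂ lam β γ T N) (Ioi 0) ∧
      ∫ t in Ioi 0, survival ω₂ lam β γ T N t = energyVariance ω₂ lam β γ T N / (2 * γ * T ^ 2) := by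
  have hanti := survival_antitoneOn hω hl hβ hγ hT hsum
  have hii : ∀ t : ℝ, 0 ≤ t → IntervalIntegrable (survival ω₂ lam β γ T N) volume 0 t := fun t ht =>
    (hanti.mono (by rw [uIcc_of_le ht]; exact Icc_subset_Ici_self)).intervalIntegrable
  have hlim : Tendsto (fun t => ∫ s in (0 : ℝ)..t, survival ω₂ lam β γ T N s) atTop
      (𝓝 (energyVariance ω₂ lam β γ T N / (2 * γ * T ^ 2))) := by
    have h := tendsto_storageResponse hω hl hβ hγ (by omega : 0 < N) hT
    rw [energyPairing_eq_half_variance hω hl hβ hγ hN hT, div_div] at h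
    refine h.congr' ?_
    filter_upwards [eventually_ge_atTop (0 : ℝ)] with t ht
    exact storageResponse_eq_integral_survival hω hl hβ hγ hN hT ht
  have hnorm : ∀ᶠ t : ℝ in atTop, (∫ s in (0 : ℝ)..t, ‖survival ω₂ lam β γ T N s‖) =
      ∫ s in (0 : ℝ)..t, survival ω₂ lam β γ T N s := by
    filter_upwards [eventually_ge_atTop (0 : ℝ)] with t ht
    refine intervalIntegral.integral_congr fun s hs => ?_
    rw [uIcc_of_le ht] at hs
    exact Real.norm_of_nonneg (survival_nonneg hγ.le hsum hs.1)
  have hint : IntegrableOn (survival ω₂ lam β γ T N) (Ioi 0) := by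
    refine integrableOn_Ioi_of_intervalIntegral_norm_tendsto (energyVariance ω₂ lam β γ T N / (2 * γ * T ^ 2)) 0
      (fun t : ℝ => ?_) tendsto_id (hlim.congr' (hnorm.mono fun t ht => ht.symm))
    rcases le_or_gt 0 t with ht | ht
    · exact (intervalIntegrable_iff_integrableOn_Ioc_of_le ht).1 (hii t ht)
    · have he : Ioc (0 : ℝ) (id t) = ∅ := Ioc_eq_empty (not_lt.2 ht.le)
      rw [he]
      exact integrableOn_empty
  refine ⟨hint, tendsto_nhds_unique (intervalIntegral_tendsto_integral_Ioi 0 hint tendsto_id) hlim⟩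

end Pinned

end SurvivalSumRule

end Summit.AtomisticToContinuum.FouriersLaw.Theorems.BoundedResponse.ParityFloor
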